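import Literature.AlgebraicGeometry.HodgeTheory.GeneralHodgeCMTypeOfCodimTwo
import Literature.AlgebraicGeometry.HodgeTheory.WeilClassesCMReduction
import HarnessLib

/-!
# What the Hodge conjecture for CM abelian varieties needs, in print: Weil classes of `E`-rank four (André 1992 in codimension two, then Hazama 2003)

Family `hodge`, layer `Literature/AlgebraicGeometry/HodgeTheory`. Written by the literature seat of the cell
`pub-hodgecm` (consequence lane, `HOME/CONSEQUENCES.md` §28) as the kernel-visible COMPOSITION of two printed
reductions of the hypothesis `HC_CM = ∀ A, Milne1999.CMHodgeHypothesisAt A` (the Hodge conjecture for all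
complex abelian varieties of CM-type — the hypothesis of Milne 1999 Thm. 7.1 and of every consequence edge of that
lane), both already records of the tree:

* **André 1992** — `Andre1992_hodgeClasses_cmAbelianVariety_mem_span_pullback_weilClasses`
  (`HodgeTheory/WeilClassesCMReduction`): every Hodge class of codimension `k` on a complex CM abelian variety is
  in the span of pull-backs `g^*(ω)` of WEIL classes `ω ∈ ⋀^{2k}_E H¹(B, ℚ)` — `E = ℚ(√-d)` acting on an abelian
  `2k`-fold `B` (`weilClassesOf B ψ k d`), or `E` a CM field of degree `e > 2` acting on `B` with
  `e·(2k) = 2 dim B` (`weilClassesField B ψ P (2k)`). Sources quoted there: Charles–Schnell, *Notes on absolute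
  Hodge classes* (2014) Thm. 11.5.21; Milne's endnote M.12 to Deligne LNM 900; Y. André, Progr. Math. 102 (1992)
  1–7. Restated: J. S. Milne, *The Tate conjecture over finite fields (AIM talk)*, arXiv:0709.3040, §10 (after
  Question 10.6): "Let `A` be a CM abelian variety over `ℂ`. Then there exist CM abelian varieties `B_i` and
  homomorphisms `A → B_i` such that every Hodge class on `A` is a linear combination of the inverse images of
  split Weil classes on the `B_i`." [result of André (1992)].
* **Hazama 2003** — `Hazama2003_generalHodge_cmType_of_hodge_codimTwo`
  (`HodgeTheory/GeneralHodgeCMTypeOfCodimTwo`): for CM abelian varieties, algebraicity of the codimension-TWO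
  Hodge classes gives Grothendieck's amended GHC, hence (Grothendieck 1969 p. 301, unconditional in the tree)
  the Hodge classes of every codimension (Publ. RIMS 39 (2003) Thm. 8.3 p. 655). Restated: Milne, AIM talk,
  **Thm. 8.5**: "In order to prove the Hodge conjecture for CM abelian varieties over `ℂ`, it suffices to prove it
  in codimension 2." and §8.3: "Theorems 8.5 and 7.4 show that, in order to prove the Tate conjecture for abelian
  varieties over `𝔽`, it suffices to prove the Hodge conjecture in codimension 2."

Composing André's record AT `k = 2` with Hazama's: **(H) follows from the algebraicity of the Weil classes of
`E`-rank four** — (a) the rational `(2,2)` Weil classes `⋀⁴_E H¹(B, ℚ) ⊗ ℂ` on abelian FOURFOLDS `B` with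
`ψ ∈ End(B)`, `ψ² = -d`, `0 < d` (`E = ℚ(√-d)`: abelian fourfolds of Weil type, every imaginary quadratic field,
every discriminant), and (b) the rational `(2,2)` Weil classes `⋀⁴_E H¹(B, ℚ) ⊗ ℂ` for a CM field
`E = ℚ(ψ) ≅ ℚ[T]/(P)` of degree `e > 2` acting on an abelian variety `B` of dimension `2e` (`dim_E H¹(B, ℚ) = 4`).
Both (a) and (b) are HYPOTHESES here (open in general: (a) is known for discriminant `1`, Markman 2023 /
Floccari–Fu, and claimed for all discriminants by Markman arXiv:2502.03415 (unrefereed); nothing is asserted about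
them); the hypotheses are STRONGER than what print needs (André's `B_i` are CM abelian varieties and the classes
split Weil classes; the record of `WeilClassesCMReduction` dropped "CM" and "split", the safe direction), so the
implication proved is WEAKER than print's and a fortiori faithful.

Everything here is a THEOREM of the tree modulo the two cited records, which enter as explicit hypotheses
`(h𝔄 : Andre1992_…)`, `(h83 : Hazama2003_…)`; no definition, no new named fact.

## References

* [Andre1992HodgeCM] Y. André, *Une remarque à propos des cycles de Hodge de type CM*, Sém. Théorie des Nombres,
  Paris 1989–90, Progr. Math. 102 (1992) 1–7, Théorème.
* [CharlesSchnell2014Notes] F. Charles, C. Schnell, *Notes on absolute Hodge classes* (2014), Thm. 11.5.21 p. 510.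
* [Hazama2003GHCCM] F. Hazama, Publ. RIMS 39 (2003) 625–655, Thm. 8.3 p. 655 (Abstract p. 625).
* [Milne2007TateFiniteFieldsAIM] J. S. Milne, arXiv:0709.3040, §8 Thm. 8.3 (= Hazama 2003 §7), Prop. 8.4,
  Thm. 8.5, §8.3 first sentence, Thm. 8.6; §10 (André 1992).
* [Milne1999] J. S. Milne, Compositio Math. 117 (1999), Thm. 7.1 p. 72.
* [Markman2025SurveySecant] E. Markman, *Secant sheaves and Weil classes on abelian varieties* (ICM survey,
  arXiv:2509.23403), Thm. 1.4 (André's reduction restated).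
-/

noncomputable section

open CategoryTheory

namespace Literature.AlgebraicGeometry.HodgeTheory

open Literature.AlgebraicTopology.SingularHomology

section HodgeTheory

/-- **André 1992 at `k = 2`: codimension-two Hodge classes on a CM abelian variety from Weil classes of `E`-rank
four.** Granted André's record, if (a) the rational `(2,2)` classes of `weilClassesOf B ψ 2 d` are algebraic on every
abelian fourfold `B` with `ψ ≫ ψ = -d`, `0 < d`, and (b) the rational `(2,2)` classes of `weilClassesField B ψ P 4` are
algebraic for every CM field `ℚ(ψ) ≅ ℚ[T]/(P)` of degree `e > 2` acting on `B` with `4e = 2 dim B`, then every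
codimension-two Hodge class on every complex abelian variety of CM-type is algebraic (`CMHodgeCodimTwoHypothesisAt`):
pull-backs of algebraic classes along `A.X ⟶ B.X` are algebraic
(`map_mem_algebraicClasses_of_abelianVariety`) and `algebraicClasses` is a `ℂ`-subspace. The `k = 2` instance of
`mem_algebraicClasses_cmAbelianVariety_of_andre1992`, with hypotheses in codimension two only.
[cite: CharlesSchnell2014Notes, Thm. 11.5.21 (p. 510)] [cite: Andre1992HodgeCM, Théorème]
[cite: Milne2007TateFiniteFieldsAIM, §10 (result of André 1992)] -/
theorem cmHodgeCodimTwoHypothesisAt_of_andre1992_of_rankFourWeil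
    (h𝔄 : Andre1992_hodgeClasses_cmAbelianVariety_mem_span_pullback_weilClasses)
    (h₂ : ∀ (d : ℕ), 0 < d → ∀ (B : Motives.AbelianVariety ℂ) (ψ : B ⟶ B), B.dim = 2 * 2 →
      ψ ≫ ψ = -(d • 𝟙 B) → ∀ w : complexBetti B.X (2 * 2), IsRationalClass w →
        IsOfHodgeType (2 * 2) B.X (2 * 2) 2 2 w → w ∈ weilClassesOf B ψ 2 d → w ∈ algebraicClasses B.X 2)
    (h₃ : ∀ (B : Motives.AbelianVariety ℂ) (ψ : B ⟶ B) (P : Polynomial ℤ) (e : ℕ),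
      P.Monic → P.natDegree = e → 2 < e → Irreducible (P.map (Int.castRingHom ℚ)) →
      Polynomial.eval₂ (Int.castRingHom (CategoryTheory.End B)) (ψ : CategoryTheory.End B) P = 0 →
      e * (2 * 2) = 2 * B.dim →
      (∀ ρ : ℂ, Polynomial.eval₂ (Int.castRingHom ℂ) ρ P = 0 → starRingEnd ℂ ρ ≠ ρ) →
      (∃ Q : Polynomial ℚ, ∀ ρ : ℂ, Polynomial.eval₂ (Int.castRingHom ℂ) ρ P = 0 →
          Polynomial.eval₂ (algebraMap ℚ ℂ) ρ Q = starRingEnd ℂ ρ) →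
        ∀ w ∈ weilClassesField B ψ P (2 * 2), IsRationalClass w →
          IsOfHodgeType B.dim B.X (2 * 2) 2 2 w → w ∈ algebraicClasses B.X 2)
    (B : Motives.AbelianVariety ℂ) : CMHodgeCodimTwoHypothesisAt B := by
  intro hB hCM c hcQ hcH
  refine (Submodule.span_le.mpr ?_) (h𝔄 B hB hCM 2 c hcQ hcH)
  rintro _ (⟨B', g, d, ψ, w, hB', hd, hψ, hw, hwt, hweil, rfl⟩ | ⟨B', g, ψ, P, e, w, hP, hPe, he, hirr, hev,
    hdim, hreal, hQ, hweil, hw, hwt, rfl⟩)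
  · exact map_mem_algebraicClasses_of_abelianVariety hB B' g (h₂ d hd B' ψ hB' hψ w hw hwt hweil)
  · exact map_mem_algebraicClasses_of_abelianVariety hB B' g
      (h₃ B' ψ P e hP hPe he hirr hev hdim hreal hQ w hweil hw hwt)

/-- **(H) from Weil classes of `E`-rank four (André 1992 at `k = 2`, then Hazama 2003).** Granted the two records,
the algebraicity of (a) the Weil classes on abelian fourfolds of Weil type (every imaginary quadratic field, every
discriminant) and (b) the `E`-rank-four Weil classes for CM fields `E` of degree `> 2` gives Milne's hypothesis (H) —
the Hodge classes of EVERY codimension on EVERY complex abelian variety of CM-type are algebraic. In print: Milne,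
AIM talk, Thm. 8.5 ("it suffices to prove it in codimension 2") with §10 (André: codimension-`k` Hodge classes on CM
abelian varieties are combinations of inverse images of split Weil classes). [cite: Milne2007TateFiniteFieldsAIM, Thm. 8.5 and §10]
[cite: Hazama2003GHCCM, Thm. 8.3 p. 655] [cite: CharlesSchnell2014Notes, Thm. 11.5.21 (p. 510)] -/
theorem cmHodgeHypothesisAt_of_rankFourWeil
    (h𝔄 : Andre1992_hodgeClasses_cmAbelianVariety_mem_span_pullback_weilClasses)
    (h83 : Hazama2003_generalHodge_cmType_of_hodge_codimTwo)
    (h₂ : ∀ (d : ℕ), 0 < d → ∀ (B : Motives.AbelianVariety ℂ) (ψ : B ⟶ B), B.dim = 2 * 2 →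
      ψ ≫ ψ = -(d • 𝟙 B) → ∀ w : complexBetti B.X (2 * 2), IsRationalClass w →
        IsOfHodgeType (2 * 2) B.X (2 * 2) 2 2 w → w ∈ weilClassesOf B ψ 2 d → w ∈ algebraicClasses B.X 2)
    (h₃ : ∀ (B : Motives.AbelianVariety ℂ) (ψ : B ⟶ B) (P : Polynomial ℤ) (e : ℕ),
      P.Monic → P.natDegree = e → 2 < e → Irreducible (P.map (Int.castRingHom ℚ)) →
      Polynomial.eval₂ (Int.castRingHom (CategoryTheory.End B)) (ψ : CategoryTheory.End B) P = 0 →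
      e * (2 * 2) = 2 * B.dim →
      (∀ ρ : ℂ, Polynomial.eval₂ (Int.castRingHom ℂ) ρ P = 0 → starRingEnd ℂ ρ ≠ ρ) →
      (∃ Q : Polynomial ℚ, ∀ ρ : ℂ, Polynomial.eval₂ (Int.castRingHom ℂ) ρ P = 0 →
          Polynomial.eval₂ (algebraMap ℚ ℂ) ρ Q = starRingEnd ℂ ρ) →
        ∀ w ∈ weilClassesField B ψ P (2 * 2), IsRationalClass w →
          IsOfHodgeType B.dim B.X (2 * 2) 2 2 w → w ∈ algebraicClasses B.X 2)
    (A : Motives.AbelianVariety ℂ) : Milne1999.CMHodgeHypothesisAt A :=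
  cmHodgeHypothesisAt_of_codimTwo h83 (cmHodgeCodimTwoHypothesisAt_of_andre1992_of_rankFourWeil h𝔄 h₂ h₃) A

/-- **`GHC_CM` from Weil classes of `E`-rank four** (André 1992 at `k = 2`, then Hazama 2003 Thm. 8.3 as typed).
[cite: Hazama2003GHCCM, Thm. 8.3 p. 655] [cite: CharlesSchnell2014Notes, Thm. 11.5.21 (p. 510)] -/
theorem cmGeneralHodgeHypothesisAt_of_rankFourWeil
    (h𝔄 : Andre1992_hodgeClasses_cmAbelianVariety_mem_span_pullback_weilClasses)
    (h83 : Hazama2003_generalHodge_cmType_of_hodge_codimTwo)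
    (h₂ : ∀ (d : ℕ), 0 < d → ∀ (B : Motives.AbelianVariety ℂ) (ψ : B ⟶ B), B.dim = 2 * 2 →
      ψ ≫ ψ = -(d • 𝟙 B) → ∀ w : complexBetti B.X (2 * 2), IsRationalClass w →
        IsOfHodgeType (2 * 2) B.X (2 * 2) 2 2 w → w ∈ weilClassesOf B ψ 2 d → w ∈ algebraicClasses B.X 2)
    (h₃ : ∀ (B : Motives.AbelianVariety ℂ) (ψ : B ⟶ B) (P : Polynomial ℤ) (e : ℕ),
      P.Monic → P.natDegree = e → 2 < e → Irreducible (P.map (Int.castRingHom ℚ)) →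
      Polynomial.eval₂ (Int.castRingHom (CategoryTheory.End B)) (ψ : CategoryTheory.End B) P = 0 →
      e * (2 * 2) = 2 * B.dim →
      (∀ ρ : ℂ, Polynomial.eval₂ (Int.castRingHom ℂ) ρ P = 0 → starRingEnd ℂ ρ ≠ ρ) →
      (∃ Q : Polynomial ℚ, ∀ ρ : ℂ, Polynomial.eval₂ (Int.castRingHom ℂ) ρ P = 0 →
          Polynomial.eval₂ (algebraMap ℚ ℂ) ρ Q = starRingEnd ℂ ρ) →
        ∀ w ∈ weilClassesField B ψ P (2 * 2), IsRationalClass w →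
          IsOfHodgeType B.dim B.X (2 * 2) 2 2 w → w ∈ algebraicClasses B.X 2)
    (A : Motives.AbelianVariety ℂ) : CMGeneralHodgeHypothesisAt A :=
  cmGeneralHodgeHypothesisAt_of_codimTwo h83 (cmHodgeCodimTwoHypothesisAt_of_andre1992_of_rankFourWeil h𝔄 h₂ h₃) A

end HodgeTheory

end Literature.AlgebraicGeometry.HodgeTheory

namespace Literature.AlgebraicGeometry.Milne1999

open Literature.AlgebraicGeometry.HodgeTheory
open Literature.AlgebraicGeometry.Motives
open Literature.AlgebraicTopology.SingularHomology
open CategoryTheory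

/-- **Tate's (0.1) for every abelian variety over every finite field from Weil classes of `E`-rank four on complex
abelian varieties** (Milne, AIM talk §8.3: "in order to prove the Tate conjecture for abelian varieties over `𝔽`, it
suffices to prove the Hodge conjecture in codimension 2", here fed by André's reduction): Milne 1999 Thm. 7.1 at the
intended ℓ-adic data `E` (`Theorem71 E`), André 1992 (record), Hazama 2003 (record), and the hypotheses (a), (b) of
`cmHodgeHypothesisAt_of_rankFourWeil`. [cite: Milne2007TateFiniteFieldsAIM, §8.3 and Thm. 7.4]
[cite: Milne1999, Thm. 7.1 p. 72] [cite: Hazama2003GHCCM, Thm. 8.3 p. 655] -/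
theorem tateAV_Fq_of_rankFourWeil
    {E : ∀ (k : Type) [Field k] [Finite k] (ℓ : ℕ) [Fact ℓ.Prime] [NeZero (ℓ : k)],
      GaloisWeilCohomology k ℚ_[ℓ] (padicCyclotomicCharacter k ℓ)}
    (h71 : Theorem71 E)
    (h𝔄 : Andre1992_hodgeClasses_cmAbelianVariety_mem_span_pullback_weilClasses)
    (h83 : Hazama2003_generalHodge_cmType_of_hodge_codimTwo)
    (h₂ : ∀ (d : ℕ), 0 < d → ∀ (B : AbelianVariety ℂ) (ψ : B ⟶ B), B.dim = 2 * 2 →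
      ψ ≫ ψ = -(d • 𝟙 B) → ∀ w : complexBetti B.X (2 * 2), IsRationalClass w →
        IsOfHodgeType (2 * 2) B.X (2 * 2) 2 2 w → w ∈ weilClassesOf B ψ 2 d → w ∈ algebraicClasses B.X 2)
    (h₃ : ∀ (B : AbelianVariety ℂ) (ψ : B ⟶ B) (P : Polynomial ℤ) (e : ℕ),
      P.Monic → P.natDegree = e → 2 < e → Irreducible (P.map (Int.castRingHom ℚ)) →
      Polynomial.eval₂ (Int.castRingHom (CategoryTheory.End B)) (ψ : CategoryTheory.End B) P = 0 →
      e * (2 * 2) = 2 * B.dim →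
      (∀ ρ : ℂ, Polynomial.eval₂ (Int.castRingHom ℂ) ρ P = 0 → starRingEnd ℂ ρ ≠ ρ) →
      (∃ Q : Polynomial ℚ, ∀ ρ : ℂ, Polynomial.eval₂ (Int.castRingHom ℂ) ρ P = 0 →
          Polynomial.eval₂ (algebraMap ℚ ℂ) ρ Q = starRingEnd ℂ ρ) →
        ∀ w ∈ weilClassesField B ψ P (2 * 2), IsRationalClass w →
          IsOfHodgeType B.dim B.X (2 * 2) 2 2 w → w ∈ algebraicClasses B.X 2) :
    TateStatement01 E :=
  tateAV_Fq_of_HC_CM h71 fun A ↦ cmHodgeHypothesisAt_of_rankFourWeil h𝔄 h83 h₂ h₃ A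

end Literature.AlgebraicGeometry.Milne1999

end
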